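import Summits.AtomisticToContinuum.Crystallization.Theorems.FreeSplittingCertificatesStrictSplittingRuleCoreFirstOrderDesign
import Summits.AtomisticToContinuum.Crystallization.Theorems.FreeSplittingCertificatesStrictSplittingRuleSummableTransfer

/-!
# `StrictSplittingRule` (stmt-AtomisticToContinuum-12560): THE LINE TRUSS AS AN EXPLICIT FIRST-ORDER DESIGN `p1Beta` (P1 interpolant object, part 61)

Route `FreeSplittingCertificates`, crux r3 `StrictSplittingRule` (H12⋆ = `stub_coreJointCoercive`), unit b2b-freesplit-B gen 33.
VALUE = the first-order design of H1 (`stub_coreFirstOrderDesign`, …CoreFirstOrderDesign: stencil `Y = {(0,1,0), (0,0,1), (0,−1,1), (2,0,0)}`,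
`β(b, d, s) = λ_s·τ`, `τ` the tension of the sender's directed stencil bond in the LINE TRUSS of the receiver) as NAMED DEFINITIONS — the landed
stub hides `β` behind an existential, whereas the endpoint of the H12⋆ assembly (`coreJointCoercive_of_certificates`, part 60) and the near
certificate (G9) are statements about THIS `β`:
* `p1Stencil`, `p1TrussV` (bond vectors by parity), `p1TrussF` (loads along a line), `p1TrussTau` (line tensions), `p1TrussLam` (frame weights), **`p1Beta`**;
* `p1Beta_support` (stencilled), `p1Beta_decay` (`|β(b_p)(q−p)(s)| ≤ C·(1+‖y_q − y_p‖)⁻⁶`, the constant of `h1_tau_bound`), **`p1Beta_identity`** (H1's identity at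
  every site, at the family minimiser — `h1_identity` + zero stress), **`p1Beta_colsum`** (ZERO TOTAL TENSION: `Σ'_q β(b_p)(q−p)(s) = 0`, hence the column
  sums of the near form are `colβ_s = −β(b_p)(0)(s)` — `h1_total_tension`), `coreFirstOrderDesign_p1Beta` (H1 witnessed by `p1Beta`).
NOT a proof of H12⋆, NOT summit progress.  [folklore]
-/

noncomputable section

open Set Function Metric MeasureTheory Filter Topology
open scoped BigOperators NNReal ENNReal Classical

namespace Summit.AtomisticToContinuum.Crystallization.Theorems.StrictSplittingRuleBirth

open Literature.MathematicalPhysics.StatisticalMechanics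
open Summit.AtomisticToContinuum.Crystallization.Theorems.PalmUnimodularRigidity.LayeredLawsSelectHcp

/-! ## The objects -/

/-- The first-order stencil `Y = {(0,1,0), (0,0,1), (0,−1,1), (2,0,0)}` of the line truss. [folklore] -/
def p1Stencil : Finset (ℤ × ℤ × ℤ) := {(0, 1, 0), (0, 0, 1), (0, -1, 1), (2, 0, 0)}

/-- Bond vectors by parity of the base site: `V true d = y_d`, `V false d = −y_{−d}`. [folklore] -/
def p1TrussV (a h : ℝ) (c : Bool) (d : ℤ × ℤ × ℤ) : EuclideanSpace ℝ (Fin 3) :=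
  if c = true then hcpSite a h d else -hcpSite a h (-d)

/-- The radial load of the `n`-th node of the line `d + ℤ·s` read along `y_s`: `W′(‖V c (d+ns)‖²)·⟪V c (d+ns), y_s⟫`. [folklore] -/
def p1TrussF (a h : ℝ) (c : Bool) (s d : ℤ × ℤ × ℤ) (n : ℤ) : ℝ :=
  ljSqDeriv (‖p1TrussV a h c (d + n • s)‖ ^ 2) * inner ℝ (p1TrussV a h c (d + n • s)) (hcpSite a h s)

/-- The line tension: the tail sum of the loads on the side of the node away from the root. [folklore] -/
def p1TrussTau (a h : ℝ) (c : Bool) (s d : ℤ × ℤ × ℤ) : ℝ :=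
  if 0 ≤ inner ℝ (p1TrussV a h c d) (hcpSite a h s) then ∑' m : ℕ, p1TrussF a h c s d ((m : ℤ) + 1)
  else -(p1TrussF a h c s d 0 + ∑' m : ℕ, p1TrussF a h c s d (-((m : ℤ) + 1)))

/-- The frame weights `λ_s = 2/(3a²)` (in-layer bonds) / `1/(4h²)` (the vertical bond). [folklore] -/
def p1TrussLam (a h : ℝ) (s : ℤ × ℤ × ℤ) : ℝ :=
  if s.1 = 0 then 2 / (3 * a ^ 2) else 1 / (4 * h ^ 2)

/-- **THE LINE-TRUSS DESIGN** `β(b, d, s) = [s ∈ Y]·λ_s·τ(parity of the receiver)(s)(−d)` (the design of `stub_coreFirstOrderDesign`, named). [folklore] -/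
def p1Beta (a h : ℝ) (b : Bool) (d s : ℤ × ℤ × ℤ) : ℝ :=
  if s ∈ p1Stencil then p1TrussLam a h s * p1TrussTau a h (if Even d.1 then b else !b) s (-d) else 0

/-- The decay constant of the design (`(2/(3a²) + 1/(4h²))·K`, `K` the constant of `h1_tau_bound`). [folklore] -/
def p1BetaConst (a h : ℝ) : ℝ :=
  (2 / (3 * a ^ 2) + 1 / (4 * h ^ 2)) * (1 / 2 * (1 + (((min a h) ^ 2)⁻¹) ^ 3) *
    ((8 / 3 + (a + 2 * h) * (min a h)⁻¹) * (1 + (min a h)⁻¹) ^ 6 + 11 / 3 * ((min a h)⁻¹) ^ 6))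

/-! ## The defining equations in the shape of the `h1_*` lemmas -/

/-- `p1TrussV` unfolded. -/
theorem p1TrussV_eq (a h : ℝ) : ∀ c d, p1TrussV a h c d = if c = true then hcpSite a h d else -hcpSite a h (-d) := fun _ _ => rfl

/-- `p1TrussF` unfolded. -/
theorem p1TrussF_eq (a h : ℝ) : ∀ c s d n, p1TrussF a h c s d n =
    ljSqDeriv (‖p1TrussV a h c (d + n • s)‖ ^ 2) * inner ℝ (p1TrussV a h c (d + n • s)) (hcpSite a h s) := fun _ _ _ _ => rfl

/-- `p1TrussTau` unfolded. -/
theorem p1TrussTau_eq (a h : ℝ) : ∀ c s d, p1TrussTau a h c s d =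
    if 0 ≤ inner ℝ (p1TrussV a h c d) (hcpSite a h s) then ∑' m : ℕ, p1TrussF a h c s d ((m : ℤ) + 1)
    else -(p1TrussF a h c s d 0 + ∑' m : ℕ, p1TrussF a h c s d (-((m : ℤ) + 1))) := fun _ _ _ => rfl

/-- `p1TrussLam` unfolded. -/
theorem p1TrussLam_eq (a h : ℝ) : ∀ s, p1TrussLam a h s = if s.1 = 0 then 2 / (3 * a ^ 2) else 1 / (4 * h ^ 2) := fun _ => rfl

/-- `p1Stencil` is the stencil of H1. -/
theorem p1Stencil_eq : p1Stencil = ({(0, 1, 0), (0, 0, 1), (0, -1, 1), (2, 0, 0)} : Finset (ℤ × ℤ × ℤ)) := rfl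

/-- `p1Beta` on the stencil. -/
theorem p1Beta_of_mem (a h : ℝ) : ∀ b d s, s ∈ p1Stencil →
    p1Beta a h b d s = p1TrussLam a h s * p1TrussTau a h (if Even d.1 then b else !b) s (-d) := fun _ _ _ hs => if_pos hs

/-! ## Stencil, decay, identity, column sums -/

/-- **The design is stencilled on `p1Stencil`.** -/
theorem p1Beta_support (a h : ℝ) : ∀ b d s, s ∉ p1Stencil → p1Beta a h b d s = 0 := fun _ _ _ hs => if_neg hs

/-- The decay constant is nonnegative (for `0 < a`, `0 < h`). -/
theorem p1BetaConst_nonneg {a h : ℝ} (ha : 0 < a) (hh : 0 < h) : 0 ≤ p1BetaConst a h := by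
  unfold p1BetaConst
  have := lt_min ha hh
  positivity

/-- **Decay of the design**: `|β(b_p)(q−p)(s)| ≤ p1BetaConst·(1+‖y_q − y_p‖)⁻⁶` (the `β`-clause of `CoreJointCoercive`).  NOT a proof of H12⋆, NOT summit progress. -/
theorem p1Beta_decay {a h : ℝ} (ha : 0 < a) (hh : 0 < h) :
    ∀ p q : ℤ × ℤ × ℤ, ∀ s, |p1Beta a h (decide (Even p.1)) (q - p) s| ≤ p1BetaConst a h * ((1 + ‖hcpSite a h q - hcpSite a h p‖)⁻¹) ^ 6 := by
  intro p q s
  have hK0 : 0 ≤ 1 / 2 * (1 + (((min a h) ^ 2)⁻¹) ^ 3) *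
      ((8 / 3 + (a + 2 * h) * (min a h)⁻¹) * (1 + (min a h)⁻¹) ^ 6 + 11 / 3 * ((min a h)⁻¹) ^ 6) := by
    have := lt_min ha hh
    positivity
  by_cases hs : s ∈ p1Stencil
  · rw [p1Beta_of_mem a h _ _ _ hs, abs_mul]
    have hpar : (if Even (q - p).1 then decide (Even p.1) else !decide (Even p.1)) = decide (Even q.1) := by
      show (if Even (q.1 - p.1) then _ else _) = _
      by_cases hp : Even p.1 <;> by_cases hq : Even q.1 <;> simp [hp, hq, Int.even_sub]
    have hcov : p1TrussV a h (decide (Even q.1)) (p - q) = hcpSite a h p - hcpSite a h q := by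
      have := h1_sub_eq a h q (p - q)
      rw [add_sub_cancel] at this
      rw [this, p1TrussV_eq]
      simp
    have hb := h1_tau_bound ha hh (p1TrussV_eq a h) (p1TrussF_eq a h) (p1TrussTau_eq a h) (decide (Even q.1)) (p1Stencil_eq ▸ hs) (p - q)
    rw [hcov, norm_sub_rev] at hb
    rw [hpar, neg_sub, p1BetaConst, mul_assoc]
    refine mul_le_mul ?_ hb (abs_nonneg _) (by positivity)
    rw [p1TrussLam_eq]
    split_ifs
    · rw [abs_of_pos (by positivity)]; linarith [(by positivity : (0 : ℝ) < 1 / (4 * h ^ 2))]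
    · rw [abs_of_pos (by positivity)]; linarith [(by positivity : (0 : ℝ) < 2 / (3 * a ^ 2))]
  · rw [p1Beta_support a h _ _ _ hs, abs_zero]
    exact mul_nonneg (p1BetaConst_nonneg ha hh) (by positivity)

/-- **H1's identity for the named design, at every site** (at the family minimiser: zero site stress).  NOT a proof of H12⋆, NOT summit progress. -/
theorem p1Beta_identity {a h : ℝ} (ha : 0 < a) (hh : 0 < h) (hfam : HcpFamilyMin a h)
    (u : ℤ × ℤ × ℤ → EuclideanSpace ℝ (Fin 3)) (hu : (Function.support u).Finite) (p : ℤ × ℤ × ℤ) :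
    (∑' q : ℤ × ℤ × ℤ, (if q = p then (0 : ℝ) else
        ljSqDeriv (‖hcpSite a h q - hcpSite a h p‖ ^ 2) *
          inner ℝ (hcpSite a h q - hcpSite a h p) (u q - u p))) +
    (∑' q : ℤ × ℤ × ℤ, (if q = p then (0 : ℝ) else
        ∑ s ∈ p1Stencil, (p1Beta a h (decide (Even p.1)) (q - p) s *
            inner ℝ (hcpSite a h (p + s) - hcpSite a h p) (u (p + s) - u p) -
          p1Beta a h (decide (Even q.1)) (p - q) s *
            inner ℝ (hcpSite a h (q + s) - hcpSite a h q) (u (q + s) - u q)))) = 0 :=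
  h1_identity ha hh (p1TrussV_eq a h) (p1TrussF_eq a h) (p1TrussTau_eq a h) (core_zeroStress ha hh hfam) (p1TrussLam_eq a h)
    p1Stencil_eq (β := p1Beta a h) (p1Beta_of_mem a h) hu p

/-- **H1 witnessed by the named design.** -/
theorem coreFirstOrderDesign_p1Beta {a h : ℝ} (ha : 0 < a) (hh : 0 < h) (hfam : HcpFamilyMin a h) : CoreFirstOrderDesign a h :=
  ⟨p1Stencil, p1Beta a h, p1BetaConst a h, p1Beta_support a h, p1Beta_decay ha hh, fun u hu p => p1Beta_identity ha hh hfam u hu p⟩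

/-- **ZERO TOTAL TENSION ⇒ the column sums of the design vanish**: for `s ∈ Y` and every site `p`, the family `q ↦ β(b_p)(q−p)(s)` is summable with sum `0`.
NOT a proof of H12⋆, NOT summit progress. -/
theorem p1Beta_colsum_zero {a h : ℝ} (ha : 0 < a) (hh : 0 < h) (hfam : HcpFamilyMin a h) (p : ℤ × ℤ × ℤ) {s : ℤ × ℤ × ℤ}
    (hs : s ∈ p1Stencil) :
    Summable (fun q : ℤ × ℤ × ℤ => p1Beta a h (decide (Even p.1)) (q - p) s) ∧
      ∑' q : ℤ × ℤ × ℤ, p1Beta a h (decide (Even p.1)) (q - p) s = 0 := by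
  set b := decide (Even p.1) with hb
  obtain ⟨hsum, h0⟩ := h1_total_tension ha hh (p1TrussV_eq a h) (p1TrussF_eq a h) (p1TrussTau_eq a h) (core_zeroStress ha hh hfam)
    p1Stencil_eq b (s := s) hs
  have e : ∀ q : ℤ × ℤ × ℤ, p1Beta a h b (q - p) s = p1TrussLam a h s * p1TrussTau a h (if Even (q - p).1 then b else !b) s (-(q - p)) :=
    fun q => p1Beta_of_mem a h _ _ _ hs
  have hs' : Summable fun q : ℤ × ℤ × ℤ => p1TrussTau a h (if Even (q - p).1 then b else !b) s (-(q - p)) :=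
    hsum.comp_injective (sub_left_injective (b := p))
  refine ⟨(hs'.mul_left (p1TrussLam a h s)).congr fun q => (e q).symm, ?_⟩
  rw [tsum_congr e, tsum_mul_left]
  have : ∑' q : ℤ × ℤ × ℤ, p1TrussTau a h (if Even (q - p).1 then b else !b) s (-(q - p)) = 0 := by
    rw [← h0]
    exact (Equiv.subRight p).tsum_eq fun d => p1TrussTau a h (if Even d.1 then b else !b) s (-d)
  rw [this, mul_zero]

/-- **THE COLUMN SUMS OF THE NEAR FORM**: `Σ'_{q ≠ p} β(b_p)(q−p)(s) = −β(b_p)(0)(s)` as a `HasSum` (the `hcol` hypothesis of the endpoint for the line truss).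
NOT a proof of H12⋆, NOT summit progress. -/
theorem p1Beta_colsum {a h : ℝ} (ha : 0 < a) (hh : 0 < h) (hfam : HcpFamilyMin a h) (p : ℤ × ℤ × ℤ) :
    ∀ s ∈ p1Stencil, HasSum (fun q : ℤ × ℤ × ℤ => if q = p then (0 : ℝ) else p1Beta a h (decide (Even p.1)) (q - p) s)
      (-p1Beta a h (decide (Even p.1)) 0 s) := by
  intro s hs
  obtain ⟨hsum, h0⟩ := p1Beta_colsum_zero ha hh hfam p hs
  have hsplit := hsum.tsum_eq_add_tsum_ite p
  rw [h0, sub_self] at hsplit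
  have hg := summableTransfer_guard p hsum
  have hval : ∑' q : ℤ × ℤ × ℤ, (if q = p then (0 : ℝ) else p1Beta a h (decide (Even p.1)) (q - p) s) =
      -p1Beta a h (decide (Even p.1)) 0 s := by linarith
  exact hval ▸ hg.hasSum

end Summit.AtomisticToContinuum.Crystallization.Theorems.StrictSplittingRuleBirth

end
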